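import Mathlib
import HarnessLib

/-!
# Leibniz × Taylor-flatness bound for one piece of the positive-time synthesis (tool for the stub
# `stub_positiveTimeSynthesisCollar` of LINES «FloorInheritance» / «MarkovFloorInheritance», ym-idea-11, cruxes 23138 / 22956)

Def-free, Mathlib only.  The quantitative positive-time synthesis `PosTimeSynthC b C N` (skeletons «FloorInheritance» v5 on
23138 / «MarkovFloorInheritance» v3 on 22956) cuts a positive-time Schwartz function `v` with the FLATNESS-WEIGHTED bound
`(1 + ‖z‖)¹⁴ ‖D^m v (z)‖ ≤ Mv · min(z₀,1)^(5−m)` (`m ≤ N`) into pieces `χ · v`, where `χ` is a smooth cut-off at lattice scale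
`δ ≤ 1` (`‖D^i χ‖ ≤ A_i δ^(−i)`) living at height `min(z₀,1) ≤ L δ` and within distance `1` of its centre `c`.  This file proves
the one estimate that makes the Whitney bookkeeping summable:

  `norm_iteratedFDeriv_mul_flat_le : ‖D^m (χ v) (z)‖ ≤ K · Mv · δ⁵ · (1 + ‖c‖)^(−14) / (2δ)^m`   (`m ≤ N`),

with `K` any bound for the combinatorial sums `2¹⁴ 2^m ∑_i (m choose i) A_i L^(5−(m−i))` — i.e. the piece is an admissible
input of the single-slot synthesis `SlotSynth` at radius `ρ = 2δ` with constant `M' = K Mv δ⁵ (1+‖c‖)^(−14)`; the factor `δ⁵`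
(five orders of flatness at the mirror) beats the `δ^(−4)` pieces per layer.  HONEST FRAMING: a calculus lemma; no stub / crux /
rung / summit is proved; the Yang–Mills mass gap is NOT proved.  Cell `ym-idea-1`, width seat `ym-line-sfw-p2-w4` g21 (free
hands). [folklore]
-/

set_option autoImplicit false

noncomputable section

open scoped BigOperators ContDiff
open Set

namespace Summit.QuantumFields.YangMills.Theorems.RPOnsetFloorPosTimeSynth

/-- Exponent bookkeeping: for `i ≤ m` and `0 < δ ≤ 1`, `δ^(−i) · δ^(5−(m−i)) ≤ δ⁵ · δ^(−m)` (truncated subtraction: the total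
exponent `(m − i) + (5 − (m − i)) ≥ 5`). [folklore] -/
theorem inv_pow_mul_pow_le {δ : ℝ} (hδ : 0 < δ) (hδ1 : δ ≤ 1) {i m : ℕ} (him : i ≤ m) :
    (δ⁻¹) ^ i * δ ^ (5 - (m - i)) ≤ δ ^ 5 * (δ⁻¹) ^ m := by
  have hδi : (δ⁻¹) ^ i = δ ^ (m - i) * (δ⁻¹) ^ m := by
    rw [pow_sub₀ δ hδ.ne' him, inv_pow, inv_pow]
    field_simp
  rw [hδi, mul_assoc, mul_comm ((δ⁻¹) ^ m), ← mul_assoc, ← pow_add]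
  exact mul_le_mul_of_nonneg_right (pow_le_pow_of_le_one hδ.le hδ1 (by omega)) (by positivity)

/-- **Leibniz × flatness bound for a piece.**  `χ` smooth with `‖D^i χ‖ ≤ A_i δ^(−i)` (`i ≤ N`), supported where `0 < z₀`,
`min(z₀,1) ≤ L δ` and `‖z − c‖ ≤ 1`; `v` smooth with the flatness-weighted bound of `PosTimeSynthC`; `K` bounds the
combinatorial sums.  Then `‖D^m (χ v)(z)‖ ≤ K · Mv · δ⁵ · (1+‖c‖)^(−14) / (2δ)^m` for `m ≤ N`. [folklore] -/
theorem norm_iteratedFDeriv_mul_flat_le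
    {χ v : EuclideanSpace ℝ (Fin 4) → ℝ} {N : ℕ} (hχ : ContDiff ℝ ∞ χ) (hv : ContDiff ℝ ∞ v)
    {A : ℕ → ℝ} {δ L Mv K : ℝ} (hδ : 0 < δ) (hδ1 : δ ≤ 1) (hL : 0 ≤ L) (hMv : 0 ≤ Mv)
    (hχb : ∀ i, i ≤ N → ∀ z, ‖iteratedFDeriv ℝ i χ z‖ ≤ A i * (δ⁻¹) ^ i)
    (c : EuclideanSpace ℝ (Fin 4))
    (hsupp : ∀ z ∈ tsupport χ, 0 < z 0 ∧ min (z 0) 1 ≤ L * δ ∧ ‖z - c‖ ≤ 1)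
    (hflat : ∀ m, m ≤ N → ∀ z : EuclideanSpace ℝ (Fin 4), 0 < z 0 →
      (1 + ‖z‖) ^ 14 * ‖iteratedFDeriv ℝ m v z‖ ≤ Mv * (min (z 0) 1) ^ (5 - m))
    (hK : ∀ m, m ≤ N → (2 : ℝ) ^ 14 * 2 ^ m * ∑ i ∈ Finset.range (m + 1),
        (m.choose i : ℝ) * A i * L ^ (5 - (m - i)) ≤ K)
    {m : ℕ} (hm : m ≤ N) (z : EuclideanSpace ℝ (Fin 4)) :
    ‖iteratedFDeriv ℝ m (fun z => χ z * v z) z‖ ≤ K * Mv * δ ^ 5 * ((1 + ‖c‖) ^ 14)⁻¹ / (2 * δ) ^ m := by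
  -- nonnegativity of the constants
  have hA0 : ∀ i, i ≤ N → 0 ≤ A i := fun i hi => by
    have h := hχb i hi c
    have hpos : 0 < (δ⁻¹) ^ i := pow_pos (inv_pos.2 hδ) i
    nlinarith [norm_nonneg (iteratedFDeriv ℝ i χ c)]
  have hK0 : 0 ≤ K := by
    refine le_trans ?_ (hK m hm)
    refine mul_nonneg (by positivity) (Finset.sum_nonneg fun i hi => ?_)
    have him : i ≤ m := Nat.lt_succ_iff.1 (Finset.mem_range.1 hi)
    exact mul_nonneg (mul_nonneg (Nat.cast_nonneg _) (hA0 i (him.trans hm))) (pow_nonneg hL _)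
  have hc0 : 0 < (1 + ‖c‖) ^ 14 := by positivity
  have hRHS0 : 0 ≤ K * Mv * δ ^ 5 * ((1 + ‖c‖) ^ 14)⁻¹ / (2 * δ) ^ m := by positivity
  by_cases hz : z ∈ tsupport χ
  · -- the Leibniz estimate
    obtain ⟨hz0, hmin, hzc⟩ := hsupp z hz
    have hmin0 : 0 ≤ min (z 0) 1 := le_min hz0.le zero_le_one
    have hz14 : 0 < (1 + ‖z‖) ^ 14 := by positivity
    -- `(1 + ‖c‖)^14 ≤ 2^14 (1 + ‖z‖)^14`
    have hcz : ((1 + ‖z‖) ^ 14)⁻¹ ≤ 2 ^ 14 * ((1 + ‖c‖) ^ 14)⁻¹ := by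
      have h1 : 1 + ‖c‖ ≤ 2 * (1 + ‖z‖) := by
        have : ‖c‖ ≤ ‖z‖ + ‖z - c‖ := by
          calc ‖c‖ = ‖z - (z - c)‖ := by rw [sub_sub_cancel]
            _ ≤ ‖z‖ + ‖z - c‖ := norm_sub_le _ _
        linarith [norm_nonneg z]
      have h2 : (1 + ‖c‖) ^ 14 ≤ 2 ^ 14 * (1 + ‖z‖) ^ 14 := by
        calc (1 + ‖c‖) ^ 14 ≤ (2 * (1 + ‖z‖)) ^ 14 := pow_le_pow_left₀ (by positivity) h1 14
          _ = 2 ^ 14 * (1 + ‖z‖) ^ 14 := by ring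
      rw [inv_le_iff_one_le_mul₀ hz14]
      calc (1 : ℝ) = (1 + ‖c‖) ^ 14 * ((1 + ‖c‖) ^ 14)⁻¹ := (mul_inv_cancel₀ hc0.ne').symm
        _ ≤ 2 ^ 14 * (1 + ‖z‖) ^ 14 * ((1 + ‖c‖) ^ 14)⁻¹ := mul_le_mul_of_nonneg_right h2 (by positivity)
        _ = 2 ^ 14 * ((1 + ‖c‖) ^ 14)⁻¹ * (1 + ‖z‖) ^ 14 := by ring
    -- pointwise derivative bounds for `v`
    have hvb : ∀ k, k ≤ N → ‖iteratedFDeriv ℝ k v z‖ ≤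
        Mv * (L * δ) ^ (5 - k) * (2 ^ 14 * ((1 + ‖c‖) ^ 14)⁻¹) := by
      intro k hk
      have h := hflat k hk z hz0
      have h' : ‖iteratedFDeriv ℝ k v z‖ ≤ Mv * (min (z 0) 1) ^ (5 - k) * ((1 + ‖z‖) ^ 14)⁻¹ := by
        rw [← div_eq_mul_inv, le_div_iff₀ hz14, mul_comm]; exact h
      refine h'.trans ?_
      have hp : (min (z 0) 1) ^ (5 - k) ≤ (L * δ) ^ (5 - k) := pow_le_pow_left₀ hmin0 hmin _
      calc Mv * (min (z 0) 1) ^ (5 - k) * ((1 + ‖z‖) ^ 14)⁻¹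
          ≤ Mv * (L * δ) ^ (5 - k) * ((1 + ‖z‖) ^ 14)⁻¹ := by gcongr
        _ ≤ Mv * (L * δ) ^ (5 - k) * (2 ^ 14 * ((1 + ‖c‖) ^ 14)⁻¹) :=
            mul_le_mul_of_nonneg_left hcz (by positivity)
    -- Leibniz
    have hχm : ContDiff ℝ m χ := hχ.of_le (mod_cast le_top)
    have hvm : ContDiff ℝ m v := hv.of_le (mod_cast le_top)
    refine (norm_iteratedFDeriv_mul_le hχm hvm z le_rfl).trans ?_
    -- term-by-term
    have hterm : ∀ i ∈ Finset.range (m + 1),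
        (m.choose i : ℝ) * ‖iteratedFDeriv ℝ i χ z‖ * ‖iteratedFDeriv ℝ (m - i) v z‖ ≤
          (2 : ℝ) ^ 14 * 2 ^ m * ((m.choose i : ℝ) * A i * L ^ (5 - (m - i))) *
            (Mv * δ ^ 5 * ((1 + ‖c‖) ^ 14)⁻¹ / (2 * δ) ^ m) := by
      intro i hi
      have him : i ≤ m := Nat.lt_succ_iff.1 (Finset.mem_range.1 hi)
      have h1 := hχb i (him.trans hm) z
      have h2 := hvb (m - i) (by omega)
      have hAi := hA0 i (him.trans hm)
      calc (m.choose i : ℝ) * ‖iteratedFDeriv ℝ i χ z‖ * ‖iteratedFDeriv ℝ (m - i) v z‖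
          ≤ (m.choose i : ℝ) * (A i * (δ⁻¹) ^ i) * (Mv * (L * δ) ^ (5 - (m - i)) * (2 ^ 14 * ((1 + ‖c‖) ^ 14)⁻¹)) :=
            mul_le_mul (mul_le_mul_of_nonneg_left h1 (Nat.cast_nonneg _)) h2 (norm_nonneg _)
              (mul_nonneg (Nat.cast_nonneg _) (mul_nonneg hAi (by positivity)))
        _ = (2 : ℝ) ^ 14 * ((m.choose i : ℝ) * A i * L ^ (5 - (m - i))) *
              (Mv * ((1 + ‖c‖) ^ 14)⁻¹) * ((δ⁻¹) ^ i * δ ^ (5 - (m - i))) := by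
            rw [mul_pow]; ring
        _ ≤ (2 : ℝ) ^ 14 * ((m.choose i : ℝ) * A i * L ^ (5 - (m - i))) *
              (Mv * ((1 + ‖c‖) ^ 14)⁻¹) * (δ ^ 5 * (δ⁻¹) ^ m) :=
            mul_le_mul_of_nonneg_left (inv_pow_mul_pow_le hδ hδ1 him) (by positivity)
        _ = (2 : ℝ) ^ 14 * 2 ^ m * ((m.choose i : ℝ) * A i * L ^ (5 - (m - i))) *
              (Mv * δ ^ 5 * ((1 + ‖c‖) ^ 14)⁻¹ / (2 * δ) ^ m) := by
            rw [mul_pow, inv_pow]; field_simp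
    have hX0 : 0 ≤ Mv * δ ^ 5 * ((1 + ‖c‖) ^ 14)⁻¹ / (2 * δ) ^ m := by positivity
    refine (Finset.sum_le_sum hterm).trans ?_
    rw [← Finset.sum_mul, ← Finset.mul_sum]
    calc (2 : ℝ) ^ 14 * 2 ^ m * (∑ i ∈ Finset.range (m + 1), (m.choose i : ℝ) * A i * L ^ (5 - (m - i))) *
          (Mv * δ ^ 5 * ((1 + ‖c‖) ^ 14)⁻¹ / (2 * δ) ^ m)
        ≤ K * (Mv * δ ^ 5 * ((1 + ‖c‖) ^ 14)⁻¹ / (2 * δ) ^ m) := mul_le_mul_of_nonneg_right (hK m hm) hX0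
      _ = K * Mv * δ ^ 5 * ((1 + ‖c‖) ^ 14)⁻¹ / (2 * δ) ^ m := by ring
  · -- outside the support the derivative vanishes
    have hsub : tsupport (iteratedFDeriv ℝ m fun z => χ z * v z) ⊆ tsupport χ :=
      (tsupport_iteratedFDeriv_subset m).trans
        (tsupport_mul_subset_left (f := χ) (g := v))
    rw [image_eq_zero_of_notMem_tsupport fun h => hz (hsub h), norm_zero]
    exact hRHS0

end Summit.QuantumFields.YangMills.Theorems.RPOnsetFloorPosTimeSynth

end
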